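import Summits.Langlands.Langlands.Theses.BanalAuxiliarySplit

/-!
# Route BanalAuxiliarySplit — Assembly

The assembly item (stmt-Langlands-27582) of the child route `BanalAuxiliarySplit` (decomp-langlands lens-3 gen 28 kit, framing A;
`--refines route-Langlands-AuxiliaryLevelSplit:LevelFiniteness`, thaw slot 7, the 96th cell route) for
U = `AuxiliaryLevelSplit.LevelFiniteness` (stmt-Langlands-27042):
`SemistableShaping → AuxiliaryBanality → BanalConfinement → Summit.Langlands.Langlands.Theses.AuxiliaryLevelSplit.LevelFiniteness`.

This is literally the type of the route file's sorry-free deciding theorem `Summit.Langlands.Langlands.Theses.BanalAuxiliarySplit.closes`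
(SSH: level-free ⟹ semistably shaped; AUXB: semistably shaped ⟹ banally shaped; BNC: banally shaped ⟹ bounded level).
Nothing here proves `Langlands` (nor the parent piece U): the assembly records only that the items of the route, taken together, imply the
parent piece by name.
-/

set_option linter.dupNamespace false -- project-wide option (lakefile weak.linter.dupNamespace); `Summit.Langlands.Langlands` is the mandated namespace

namespace Summit.Langlands.Langlands.Theorems

/-- **Assembly of route BanalAuxiliarySplit** (stmt-Langlands-27582):
`SemistableShaping → AuxiliaryBanality → BanalConfinement → Summit.Langlands.Langlands.Theses.AuxiliaryLevelSplit.LevelFiniteness`.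
Proof: unfold `Assembly` and apply the route's deciding theorem `Theses.BanalAuxiliarySplit.closes`. -/
theorem banalAuxiliarySplit_assembly_proof :
    Summit.Langlands.Langlands.Theses.BanalAuxiliarySplit.Assembly := by
  unfold Summit.Langlands.Langlands.Theses.BanalAuxiliarySplit.Assembly
  exact Summit.Langlands.Langlands.Theses.BanalAuxiliarySplit.closes

end Summit.Langlands.Langlands.Theorems
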